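import Summits.CriticalPhenomena.SAWScalingLimit.Theorems.SAWLoopFugacityFlowIsingBoundaryRatioWindowRectHoles
import Mathlib.Analysis.Complex.AbsMax
import HarnessLib

/-!
# Chart values at the corners of hole faces: the maximum principle
(line `fk-anchor-transfer`, crux `IsingBoundaryRatio`, stmt-CriticalPhenomena-10650; helper file of the stub
`windowRectPresentation_holds`)

Let `E₀` be a finite set of edges of the mesh graph `Ω_δ` of a Jordan domain `D` and let `g` be continuous
on `closure D ∖ {b}`, holomorphic and non-vanishing on `D` (in the application: the Carathéodory extension of
the chordal chart, which vanishes only at the marked point `a ∈ ∂D` and blows up at `b ∈ ∂D`). If along every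
edge of `E₀` one has `lo ≤ ‖g‖ ≤ hi` (`0 < lo`) and the edges avoid `b`, then `lo ≤ ‖g(δv)‖ ≤ hi` at every
corner `v` of every HOLE FACE of `E₀` (`…WindowRectHoles`): the union `K` of the closed hole faces has its
topological boundary on edges of `E₀` (a point of `K` interior to a hole face, to a side between two hole
faces, or a vertex all of whose faces are hole faces, is interior to `K`; otherwise it lies on the common side
of a hole face and a non-hole face, an edge of `E₀`), its interior lies in `D` (it misses the exterior by
`disjoint_cell_exterior_of_hole`, hence the boundary curve), and the maximum modulus principle
(`Complex.norm_le_of_forall_mem_frontier_norm_le`) applied to `g` and `1/g` on the interior of `K` gives the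
two bounds on `K = closure (interior K)`. [folklore]
-/

noncomputable section

open Set Metric Complex SimpleGraph Literature.Probability.RandomPlanarGeometry Literature.Probability.LatticeModels
  Literature.Probability.LatticeModels.Mesh Literature.Probability.LatticeModels.DiscreteRect

namespace Summit.CriticalPhenomena.SAWScalingLimit.Theorems.IsingBoundaryRatio

namespace WindowRect

variable (D : JordanDomain) {δ : ℝ} (hδ : 0 < δ) {E₀ : Finset (Sym2 (Site 2))}
  (hE₀ : ∀ e ∈ E₀, e ∈ (discreteDomainGraph D.carrier δ).edgeSet)
  {S : Site 2 → Site 2 → Prop}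
  (hS : ∀ a b, S a b ↔ ∃ k : Fin 4, b = a + cornerUnit k ∧ s(a + cornerOff (k + 1), a + cornerOff (k + 2)) ∉ E₀)

include hS in
/-- A point of the common side of a hole face and a side-adjacent non-hole face lies on an edge of `E₀`.
[folklore] -/
theorem exists_edge_of_transition {a b : Site 2}
    (ha : ¬ ∀ M : ℤ, ∃ g' : Site 2, M ≤ g' 1 ∧ Relation.ReflTransGen S a g')
    (hb : ∀ M : ℤ, ∃ g' : Site 2, M ≤ g' 1 ∧ Relation.ReflTransGen S b g') (hab : (zdGraph 2).Adj a b)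
    {v w : Site 2} (hva : IsCorner v a) (hvb : IsCorner v b) (hwa : IsCorner w a) (hwb : IsCorner w b)
    {z : ℂ} (hz : z ∈ segment ℝ (meshPoint δ v) (meshPoint δ w)) :
    ∃ x y : Site 2, s(x, y) ∈ E₀ ∧ z ∈ segment ℝ (meshPoint δ x) (meshPoint δ y) := by
  obtain ⟨k, rfl⟩ := exists_eq_add_cornerUnit hab
  have hmem := mem_of_hole_of_not_hole hS ha hb
  rcases eq_of_isCorner_of_isCorner_add hva hvb with rfl | rfl <;>
    rcases eq_of_isCorner_of_isCorner_add hwa hwb with rfl | rfl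
  · rw [segment_same, mem_singleton_iff] at hz
    subst hz
    exact ⟨_, _, hmem, left_mem_segment _ _ _⟩
  · exact ⟨_, _, hmem, hz⟩
  · exact ⟨_, _, hmem, by rw [segment_symm]; exact hz⟩
  · rw [segment_same, mem_singleton_iff] at hz
    subst hz
    exact ⟨_, _, hmem, right_mem_segment _ _ _⟩

include hS hδ in
/-- **The boundary of the union of the closed hole faces lies on edges of `E₀`.** A point of a closed hole
face that is not interior to the union `K` lies on an edge of `E₀`. [folklore] -/
theorem exists_edge_of_not_mem_interior {r' : Site 2}
    (hr' : ¬ ∀ M : ℤ, ∃ g' : Site 2, M ≤ g' 1 ∧ Relation.ReflTransGen S r' g') {z : ℂ}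
    (hzr : z ∈ closure (cell δ (r' 0) (r' 1)))
    (hzi : z ∉ interior (cellUnion δ {a : Site 2 | ¬ ∀ M : ℤ, ∃ g' : Site 2, M ≤ g' 1 ∧ Relation.ReflTransGen S a g'})) :
    ∃ x y : Site 2, s(x, y) ∈ E₀ ∧ z ∈ segment ℝ (meshPoint δ x) (meshPoint δ y) := by
  classical
  set H : Set (Site 2) := {a : Site 2 | ¬ ∀ M : ℤ, ∃ g' : Site 2, M ≤ g' 1 ∧ Relation.ReflTransGen S a g'} with hH
  set K := cellUnion δ H with hK
  have hrK : ∀ r ∈ H, closure (cell δ (r 0) (r 1)) ⊆ K := fun r hr => closure_cell_subset_cellUnion hr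
  have key : ∀ U : Set ℂ, IsOpen U → z ∈ U → U ⊆ K → False := fun U hU hzU hUK =>
    hzi (interior_maximal hUK hU hzU)
  have hr'H : r' ∈ H := hr'
  set k := r' 0 with hk
  set j := r' 1 with hj
  rw [closure_cell hδ, mem_reProdIm] at hzr
  obtain ⟨hre, him⟩ := hzr
  have hδk : δ * k < δ * (k + 1) := by nlinarith
  have hδj : δ * j < δ * (j + 1) := by nlinarith
  -- transitions give edges
  have htrans : ∀ {a b : Site 2}, a ∈ H → b ∉ H → (zdGraph 2).Adj a b → ∀ {v w : Site 2},
      IsCorner v a → IsCorner v b → IsCorner w a → IsCorner w b →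
      z ∈ segment ℝ (meshPoint δ v) (meshPoint δ w) →
      ∃ x y : Site 2, s(x, y) ∈ E₀ ∧ z ∈ segment ℝ (meshPoint δ x) (meshPoint δ y) := by
    intro a b ha hb hab v w hva hvb hwa hwb hz
    simp only [hH, Set.mem_setOf_eq, not_not] at ha hb
    exact exists_edge_of_transition hS ha hb hab hva hvb hwa hwb hz
  by_cases hreo : z.re ∈ Ioo (δ * k) (δ * (k + 1))
  · by_cases himo : z.im ∈ Ioo (δ * j) (δ * (j + 1))
    · exact (key _ (isOpen_cell δ k j) ⟨hreo, himo⟩ ((subset_closure).trans (hrK r' hr'H))).elim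
    · obtain ⟨j₀, hj₀, hlow, hup⟩ : ∃ j₀ : ℤ, z.im = δ * j₀ ∧
          ((![k, j₀ - 1] : Site 2) ∈ H ∨ (![k, j₀] : Site 2) ∈ H) ∧
          (zdGraph 2).Adj (![k, j₀ - 1] : Site 2) ![k, j₀] := by
        have hr'eq : r' = ![k, j] := funext fun i => by fin_cases i <;> simp [hk, hj]
        have hadj : ∀ j₀ : ℤ, (zdGraph 2).Adj (![k, j₀ - 1] : Site 2) ![k, j₀] := fun j₀ => by
          convert zdGraph_adj_add_cornerUnit (![k, j₀ - 1] : Site 2) 1 using 1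
          exact funext fun i => by fin_cases i <;> simp
        rcases eq_or_eq_of_mem_Icc_of_not_mem_Ioo him himo with h | h
        · refine ⟨j, h, Or.inr ?_, hadj j⟩; rw [← hr'eq]; exact hr'H
        · refine ⟨j + 1, by rw [h]; push_cast; ring, Or.inl ?_, hadj (j + 1)⟩
          rw [show (j + 1 - 1 : ℤ) = j by ring, ← hr'eq]; exact hr'H
      have hc : ∀ f : Site 2, f = ![k, j₀ - 1] ∨ f = ![k, j₀] →
          IsCorner ![k, j₀] f ∧ IsCorner ![k + 1, j₀] f := by
        rintro f (rfl | rfl) <;> constructor <;> refine isCorner_of_coords ?_ ?_ <;> simp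
      have hzseg : z ∈ segment ℝ (meshPoint δ ![k, j₀]) (meshPoint δ ![k + 1, j₀]) := by
        rw [meshPoint_vec, meshPoint_vec]; push_cast
        exact mem_segment_of_im_eq hδk hre hj₀
      by_cases hboth : (![k, j₀ - 1] : Site 2) ∈ H ∧ (![k, j₀] : Site 2) ∈ H
      · refine (key _ (isOpen_Ioo.reProdIm isOpen_Ioo) ?_ ((rect_subset_closure_cells_h hδ k j₀).trans ?_)).elim
        · rw [mem_reProdIm]; refine ⟨hreo, ?_, ?_⟩ <;> rw [hj₀] <;> nlinarith
        · refine Set.union_subset ?_ ?_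
          · have := hrK _ hboth.1; simpa using this
          · have := hrK _ hboth.2; simpa using this
      · have hc1 := hc _ (Or.inl rfl)
        have hc2 := hc _ (Or.inr rfl)
        rcases hlow with h | h
        · exact htrans h (fun h' => hboth ⟨h, h'⟩) hup hc1.1 hc2.1 hc1.2 hc2.2 hzseg
        · exact htrans h (fun h' => hboth ⟨h', h⟩) hup.symm hc2.1 hc1.1 hc2.2 hc1.2 hzseg
  · obtain ⟨k₀, hk₀, hk₀'⟩ : ∃ k₀ : ℤ, z.re = δ * k₀ ∧ (k₀ = k ∨ k₀ = k + 1) := by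
      rcases eq_or_eq_of_mem_Icc_of_not_mem_Ioo hre hreo with h | h
      · exact ⟨k, h, Or.inl rfl⟩
      · exact ⟨k + 1, by rw [h]; push_cast; ring, Or.inr rfl⟩
    by_cases himo : z.im ∈ Ioo (δ * j) (δ * (j + 1))
    · have hlow : (![k₀ - 1, j] : Site 2) ∈ H ∨ (![k₀, j] : Site 2) ∈ H := by
        have hr'eq : r' = ![k, j] := funext fun i => by fin_cases i <;> simp [hk, hj]
        rcases hk₀' with rfl | rfl
        · right; rw [← hr'eq]; exact hr'H
        · left; rw [show (k + 1 - 1 : ℤ) = k by ring, ← hr'eq]; exact hr'H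
      have hup : (zdGraph 2).Adj (![k₀ - 1, j] : Site 2) ![k₀, j] := by
        convert zdGraph_adj_add_cornerUnit (![k₀ - 1, j] : Site 2) 0 using 1
        exact funext fun i => by fin_cases i <;> simp
      have hc : ∀ f : Site 2, f = ![k₀ - 1, j] ∨ f = ![k₀, j] →
          IsCorner ![k₀, j] f ∧ IsCorner ![k₀, j + 1] f := by
        rintro f (rfl | rfl) <;> constructor <;> refine isCorner_of_coords ?_ ?_ <;> simp
      have hzseg : z ∈ segment ℝ (meshPoint δ ![k₀, j]) (meshPoint δ ![k₀, j + 1]) := by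
        rw [meshPoint_vec, meshPoint_vec]; push_cast
        exact mem_segment_of_re_eq hδj him hk₀
      by_cases hboth : (![k₀ - 1, j] : Site 2) ∈ H ∧ (![k₀, j] : Site 2) ∈ H
      · refine (key _ (isOpen_Ioo.reProdIm isOpen_Ioo) ?_ ((rect_subset_closure_cells_v hδ k₀ j).trans ?_)).elim
        · rw [mem_reProdIm]; refine ⟨⟨?_, ?_⟩, himo⟩ <;> rw [hk₀] <;> nlinarith
        · refine Set.union_subset ?_ ?_
          · have := hrK _ hboth.1; simpa using this
          · have := hrK _ hboth.2; simpa using this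
      · have hc1 := hc _ (Or.inl rfl)
        have hc2 := hc _ (Or.inr rfl)
        rcases hlow with h | h
        · exact htrans h (fun h' => hboth ⟨h, h'⟩) hup hc1.1 hc2.1 hc1.2 hc2.2 hzseg
        · exact htrans h (fun h' => hboth ⟨h', h⟩) hup.symm hc2.1 hc1.1 hc2.2 hc1.2 hzseg
    · obtain ⟨j₀, hj₀, hj₀'⟩ : ∃ j₀ : ℤ, z.im = δ * j₀ ∧ (j₀ = j ∨ j₀ = j + 1) := by
        rcases eq_or_eq_of_mem_Icc_of_not_mem_Ioo him himo with h | h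
        · exact ⟨j, h, Or.inl rfl⟩
        · exact ⟨j + 1, by rw [h]; push_cast; ring, Or.inr rfl⟩
      set v : Site 2 := ![k₀, j₀] with hv
      have hzv : z = meshPoint δ v := by rw [hv, meshPoint_vec]; exact Complex.ext hk₀ hj₀
      have hr'c : IsCorner v r' := by
        refine isCorner_of_coords ?_ ?_
        · simp only [hv, Matrix.cons_val_zero]; rcases hk₀' with h | h <;> omega
        · simp only [hv, Matrix.cons_val_one, Matrix.cons_val_zero]; rcases hj₀' with h | h <;> omega
      obtain ⟨i₀, hi₀⟩ := exists_faceAt_of_isCorner hr'c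
      by_cases hall : ∀ i : Fin 4, faceAt v i ∈ H
      · refine (key _ (isOpen_Ioo.reProdIm isOpen_Ioo) ?_ ((square_subset_closure_cells hδ k₀ j₀).trans ?_)).elim
        · rw [mem_reProdIm]; refine ⟨⟨?_, ?_⟩, ?_, ?_⟩ <;> simp only [hk₀, hj₀] <;> nlinarith
        · have h0 := hrK _ (hall 0); have h1 := hrK _ (hall 1); have h2 := hrK _ (hall 2); have h3 := hrK _ (hall 3)
          simp only [faceAt, hv, cornerOff, Pi.sub_apply, Matrix.cons_val_zero, Matrix.cons_val_one,
            Pi.add_apply, Pi.single_eq_same, Pi.single_eq_of_ne (show (1 : Fin 2) ≠ 0 by decide),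
            Pi.single_eq_of_ne (show (0 : Fin 2) ≠ 1 by decide), sub_zero, Pi.zero_apply] at h0 h1 h2 h3
          refine Set.union_subset (Set.union_subset ?_ ?_) (Set.union_subset ?_ ?_)
          · simpa using h2
          · simpa using h3
          · simpa using h1
          · simpa using h0
      · push Not at hall
        have hstep : ∃ i : Fin 4, faceAt v i ∈ H ∧ faceAt v (i + 1) ∉ H := by
          by_contra hno
          push Not at hno
          obtain ⟨i₁, hi₁⟩ := hall
          have h0 : faceAt v i₀ ∈ H := hi₀ ▸ hr'H
          have h1 := hno _ h0
          have h2 := hno _ h1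
          have h3 := hno _ h2
          have : i₁ = i₀ ∨ i₁ = i₀ + 1 ∨ i₁ = i₀ + 1 + 1 ∨ i₁ = i₀ + 1 + 1 + 1 := by omega
          rcases this with rfl | rfl | rfl | rfl
          · exact hi₁ h0
          · exact hi₁ h1
          · exact hi₁ h2
          · exact hi₁ h3
        obtain ⟨i, hiR, hiR'⟩ := hstep
        -- the common side of these two faces has `v` as an end
        simp only [hH, Set.mem_setOf_eq, not_not] at hiR hiR'
        have hadj : (zdGraph 2).Adj (faceAt v i) (faceAt v (i + 1)) := by
          rw [faceAt_succ_eq]; exact zdGraph_adj_add_cornerUnit _ _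
        obtain ⟨k', hk'⟩ := exists_eq_add_cornerUnit hadj
        have hmem := mem_of_hole_of_not_hole hS hiR (hk' ▸ hiR')
        refine ⟨_, _, hmem, ?_⟩
        rw [hzv]
        rcases eq_of_isCorner_of_isCorner_add (isCorner_faceAt v i) (hk' ▸ isCorner_faceAt v (i + 1)) with h | h
        · rw [← h]; exact left_mem_segment _ _ _
        · rw [← h]; exact right_mem_segment _ _ _

include hS hδ hE₀ in
/-- **Chart bounds at the corners of hole faces** (maximum principle). See the module docstring.
[folklore] -/
theorem norm_chart_corner_hole {g : ℂ → ℂ} {b : ℂ} {lo hi : ℝ} (hlo : 0 < lo)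
    (hgc : ContinuousOn g (closure D.carrier \ {b})) (hgd : DifferentiableOn ℂ g D.carrier) (hb : b ∉ D.carrier)
    (hgD : ∀ z ∈ D.carrier, g z ≠ 0)
    (hbd : ∀ x y : Site 2, s(x, y) ∈ E₀ → ∀ z ∈ segment ℝ (meshPoint δ x) (meshPoint δ y),
      z ≠ b ∧ lo ≤ ‖g z‖ ∧ ‖g z‖ ≤ hi)
    {h : Site 2} (hh : ¬ ∀ M : ℤ, ∃ g' : Site 2, M ≤ g' 1 ∧ Relation.ReflTransGen S h g') {v : Site 2}
    (hv : IsCorner v h) : lo ≤ ‖g (meshPoint δ v)‖ ∧ ‖g (meshPoint δ v)‖ ≤ hi := by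
  classical
  set H : Set (Site 2) := {a : Site 2 | ¬ ∀ M : ℤ, ∃ g' : Site 2, M ≤ g' 1 ∧ Relation.ReflTransGen S a g'} with hH
  have hHfin : H.Finite := finite_hole hS
  have hHcl := hole_closure_property D hE₀ hS
  have hhH : h ∈ H := hh
  set K := cellUnion δ H with hK
  have hKcl : IsClosed K := isClosed_cellUnion δ hHfin
  have hKbdd : Bornology.IsBounded K := isBounded_cellUnion hδ hHfin
  have hrK : ∀ r ∈ H, closure (cell δ (r 0) (r 1)) ⊆ K := fun r hr => closure_cell_subset_cellUnion hr
  set U := interior K with hU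
  have hUbdd : Bornology.IsBounded U := hKbdd.subset interior_subset
  have hclU : closure U ⊆ K := closure_minimal interior_subset hKcl
  -- points of `K`: interior, or on an edge of `E₀`
  have Kpts : ∀ z ∈ K, z ∈ U ∨ ∃ x y : Site 2, s(x, y) ∈ E₀ ∧ z ∈ segment ℝ (meshPoint δ x) (meshPoint δ y) := by
    intro z hz
    by_cases hzi : z ∈ interior K
    · exact Or.inl hzi
    · obtain ⟨r', hr'H, hzr'⟩ : ∃ r' ∈ H, z ∈ closure (cell δ (r' 0) (r' 1)) := by
        simpa only [hK, cellUnion, Set.mem_iUnion, exists_prop] using hz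
      exact Or.inr (exists_edge_of_not_mem_interior hδ hS hr'H hzr' hzi)
  -- `K ⊆ closure D`, `U ⊆ D`, `b ∉ K`
  have hKD : K ⊆ closure D.carrier := by
    intro z hz
    obtain ⟨r', hr'H, hzr'⟩ : ∃ r' ∈ H, z ∈ closure (cell δ (r' 0) (r' 1)) := by
      simpa only [hK, cellUnion, Set.mem_iUnion, exists_prop] using hz
    exact closure_cell_subset_of_hole D hδ hHfin hHcl hr'H hzr'
  have hUD : U ⊆ D.carrier := by
    intro z hzU
    by_contra hzD
    have hzfr : z ∈ frontier D.carrier := by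
      rw [D.isOpen.frontier_eq]; exact ⟨hKD (interior_subset hzU), hzD⟩
    have hzE : z ∈ closure (closure D.carrier)ᶜ :=
      D.frontier_subset_closure_exterior Literature.Topology.PlaneTopology.JordanCurveTheorem_holds hzfr
    obtain ⟨e, heU, heE⟩ : (U ∩ (closure D.carrier)ᶜ).Nonempty :=
      _root_.mem_closure_iff.1 hzE U isOpen_interior hzU
    obtain ⟨r', hr'H, her'⟩ : ∃ r' ∈ H, e ∈ closure (cell δ (r' 0) (r' 1)) := by
      simpa only [hK, cellUnion, Set.mem_iUnion, exists_prop] using interior_subset heU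
    obtain ⟨e', he'E, he'c⟩ : ((closure D.carrier)ᶜ ∩ cell δ (r' 0) (r' 1)).Nonempty :=
      _root_.mem_closure_iff.1 her' _ isClosed_closure.isOpen_compl heE
    exact Set.disjoint_left.1 (disjoint_cell_exterior_of_hole D hδ hHfin hHcl hr'H) he'c he'E
  have hbK : b ∉ K := by
    intro hbK
    rcases Kpts b hbK with h | ⟨x, y, hxy, hb'⟩
    · exact hb (hUD h)
    · exact (hbd x y hxy b hb').1 rfl
  have hKDb : K ⊆ closure D.carrier \ {b} := fun z hz => ⟨hKD hz, fun h => hbK (mem_singleton_iff.1 h ▸ hz)⟩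
  -- `g` on `U`
  have hdiff : DiffContOnCl ℂ g U := ⟨hgd.mono hUD, hgc.mono (hclU.trans hKDb)⟩
  have hfr : ∀ z ∈ frontier U, lo ≤ ‖g z‖ ∧ ‖g z‖ ≤ hi := by
    intro z hz
    have hzK : z ∈ K := hclU (frontier_subset_closure hz)
    rcases Kpts z hzK with h | ⟨x, y, hxy, hz'⟩
    · have hz' : z ∈ closure U \ U := by rwa [← isOpen_interior.frontier_eq]
      exact absurd h hz'.2
    · exact ⟨(hbd x y hxy z hz').2.1, (hbd x y hxy z hz').2.2⟩
  -- the corner is in `closure U`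
  have hp : meshPoint δ v ∈ closure U := by
    have h1 : cell δ (h 0) (h 1) ⊆ U := interior_maximal ((subset_closure).trans (hrK h hhH)) (isOpen_cell δ _ _)
    exact closure_mono h1 (meshPoint_mem_closure_cell_of_isCorner hδ hv)
  refine ⟨?_, Complex.norm_le_of_forall_mem_frontier_norm_le hUbdd hdiff (fun z hz => (hfr z hz).2) hp⟩
  -- lower bound: the maximum principle for `1/g`
  have hg0 : ∀ z ∈ closure U, g z ≠ 0 := by
    intro z hz
    rcases Kpts z (hclU hz) with h | ⟨x, y, hxy, hz'⟩
    · exact hgD z (hUD h)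
    · intro h0
      have := (hbd x y hxy z hz').2.1
      rw [h0, norm_zero] at this
      linarith
  have hdiff' : DiffContOnCl ℂ (fun z => (g z)⁻¹) U :=
    ⟨(hgd.mono hUD).inv fun z hz => hgD z (hUD hz), (hgc.mono (hclU.trans hKDb)).inv₀ hg0⟩
  have hfr' : ∀ z ∈ frontier U, ‖(g z)⁻¹‖ ≤ lo⁻¹ := by
    intro z hz
    rw [norm_inv]
    exact inv_anti₀ hlo (hfr z hz).1
  have h := Complex.norm_le_of_forall_mem_frontier_norm_le hUbdd hdiff' hfr' hp
  rw [norm_inv] at h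
  have hpos : 0 < ‖g (meshPoint δ v)‖ := norm_pos_iff.2 (hg0 _ hp)
  exact (inv_le_inv₀ hpos hlo).1 h

end WindowRect

/-- **Chart bounds at the corners of hole faces**, closed form (registered sub-goal of
stmt-CriticalPhenomena-10650). [folklore] -/
theorem windowRect_norm_chart_corner_hole : ∀ (D : Literature.Probability.RandomPlanarGeometry.JordanDomain) {δ : ℝ}, 0 < δ → ∀ {E₀ : Finset (Sym2 (Site 2))}, (∀ e ∈ E₀, e ∈ (discreteDomainGraph D.carrier δ).edgeSet) → ∀ {S : Site 2 → Site 2 → Prop}, (∀ a b, S a b ↔ ∃ k : Fin 4, b = a + cornerUnit k ∧ s(a + cornerOff (k + 1), a + cornerOff (k + 2)) ∉ E₀) → ∀ {g : ℂ → ℂ} {b : ℂ} {lo hi : ℝ}, 0 < lo → ContinuousOn g (closure D.carrier \ {b}) → DifferentiableOn ℂ g D.carrier → b ∉ D.carrier → (∀ z ∈ D.carrier, g z ≠ 0) → (∀ x y : Site 2, s(x, y) ∈ E₀ → ∀ z ∈ segment ℝ (meshPoint δ x) (meshPoint δ y), z ≠ b ∧ lo ≤ ‖g z‖ ∧ ‖g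 z‖ ≤ hi) → ∀ {h : Site 2}, (¬ ∀ M : ℤ, ∃ g' : Site 2, M ≤ g' 1 ∧ Relation.ReflTransGen S h g') → ∀ {v : Site 2}, IsCorner v h → lo ≤ ‖g (meshPoint δ v)‖ ∧ ‖g (meshPoint δ v)‖ ≤ hi :=
  fun D _ hδ _ hE₀ _ hS _ _ _ _ hlo hgc hgd hb hgD hbd _ hh _ hv =>
    WindowRect.norm_chart_corner_hole D hδ hE₀ hS hlo hgc hgd hb hgD hbd hh hv

end Summit.CriticalPhenomena.SAWScalingLimit.Theorems.IsingBoundaryRatio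

end
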